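import Summits.QuantumFields.YangMills.Theorems.BalabanUVNodesN09B12ZeroLetterFlatness
import Literature.MathematicalPhysics.QuantumFieldTheory.Balaban1983to89.Node00.CarriersB12FundamentalCase
import Literature.MathematicalPhysics.QuantumFieldTheory.Balaban1983to89.Node00.Record12Residuals

/-!
# NODE N09 ([Balaban1987RG1] Lemma 4 (3.53) p. 280), FLAG №7 LOCATED RIDER 3, PART 2 — THE REPAIR CRITERION IN KERNEL FORM: UNDER THE ORBIT-TIE OF THE
# BY-REFERENCE DATUM `JInputs.Φ₀` AND FIRST-ORDER NON-FLATNESS OF THE PINNED `bgI`, №209's «FAILING LEMMA» HOLDS (no zero-letter layer carries a tied `B12Provisos`),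
# WHILE THE TIE ALONE IS IDLE AT EVERY TOTALLY-FLAT RECIPE (`RzOfRecord`) — so BOTH text edits are needed, and together they bite

T. Bałaban, *Renormalization group approach to lattice gauge field theories. I*, Commun. Math. Phys. **109** (1987) 249–301 [Balaban1987RG1] (= [I]), §3 pp. 275–280;
[14] = [Balaban1985RegularSpaces]; [15] = [Balaban1985Variational] ∕ [Balaban1985BackgroundPropagators] for the lattice calculus.  TRACK A (YM-PLAN §2b), WIDTH SEAT
`pub-ymgap-dag-n09-w5` (HUMAN RULING D-0154 ∕ director-ym R399 (3a)), generation g2; LOCATED RIDER to FLAG №7 of record (director-ym №209 «conjunct-1 JUNK-INHABITED at the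
unit recipe»; chair tags #4477∕#4618 «repair = proviso text»), third in this seat's lineage after p607123 `…N09B12ProvisosJunkUnderRzLaws` (the zero-letter inhabitant of
`B12Provisos Rz cB λ` survives EVERY recipe with row P8 `Sect2.Residual.Laws`) and p608883 `…N09B12ProvisosJunkInClass` (it survives every UNIT-FLAT recipe; K1⁷'s class is
closed under the junk X-pin).  Key of record it serves: K1⁷ `StabilityBAtRecordR13SepCoPH` = stmt-QuantumFields-20542 (`--supports`, helper; count-neutral).

WHY.  p607123 ∕ p608883 locate the junk in two UNTIED data of the by-reference package: the residual LETTER MAPS `λ.K ∕ λ.A₂` and p07's `JInputs.Φ₀ ∕ 𝐇`, and say the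
№209 deliverable («pinned `Rz` ⇒ no zero-letter family satisfies `B12Provisos`, as a lemma») needs a TEXT edit.  RIDER 3 (PART 1 `…N09B12ZeroLetterFlatness` = the estimate; THIS FILE = the consequences) makes that located word
QUANTITATIVE and two-sided.  In print the upper-space datum of (3.40) («the configuration U belongs to the space U^c_{k+1}(□₀, (1+2β)α₀, (1+2β)α₁, α₀)», p. 278) IS the Lemma-4
variable `𝐔` — a member of a union of orbits of configurations satisfying (i)–(iv) (pub-balaban `B12RegularSpaces111.space`), so the honest reading of `JInputs.Φ₀`
(«the upper-space datum (3.40)», with `hΦ₀ : Satisfies …`) is: AN (i)–(iv)-REPRESENTATIVE OF THE INPUT'S ORBIT (`Φ = act u Φ₀`, `u` `Gᶜ`-valued) — the ORBIT-TIE.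
Under it, p07's identity field `h339` ((3.39)+(3.37): `∂(exp iξ𝐇)(p) = ∂((U_{k+1}(□₀, M˙(Φ₀)))^{(v ū₁ v_j u_j)⁻¹})(p)` on `X`) ties `𝐇` to the PINNED background of the
input's representative, and at `τ = 1` the zero letter `𝐊 = 0` makes the (3.45) fields `h45τ ∕ h45` read `|ℓ| < B₃y²`, `|ξ⁻¹∂𝐇 − ℓ| < B₃y²`, so the plaquette
combination `∂𝐇` is SECOND ORDER: `|∂𝐇(p)| < 2ξB₃y²` (`y = B₃O(1)Mα₀L^{j−1}η`); with (3.37) `|𝐇| < x′ = B₃²O(1)Mα₀L^{j−1}η` the elementary inequality behind (3.43)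
(`B9Eq369Product.norm_plaqU_prodCfg_sub_one_le`, CURL form, at the unit background) gives `|∂(exp iξ𝐇)(p) − 1| ≤ ξ|∂𝐇(p)| + ½(4x′)²ξ²e^{4ξx′}`, and undoing the gauge
(`plaq_gaugeU`, the four printed costs `huj ∕ hubar1 ∕ hvj ∕ hv`) yields `|∂U_{k+1}(□₀, M˙(Φ₀))(p) − 1| ≤ δ₀ := e^{c_w}·(2ξ²B₃y² + 8x′²ξ²e^{4ξx′})` on `X` —
SECOND ORDER in `α₀`, against the FIRST-ORDER window `(1+2β)α₀ξ′²` that (1.16) allows the space.  So: (TIE) + (NF: the pinned `bgI` has, for SOME admissible input, an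
X-plaquette off `1` by more than `δ₀` at EVERY representative) ⇒ no zero-`𝐊` layer carries a tied `B12Package` — №209's lemma, under the repaired text.  Conversely
the tie ALONE is idle: at a TOTALLY-FLAT recipe (`∂U_n(M˙(V)) ≡ 1`, `J_n(M˙(V)) ≡ 0` for EVERY `V` — def-T's unit recipe `Sect2.Residual.unit = RzOfRecord`) the
zero-letter package with `Φ₀ :=` the input's own representative and `𝐇 := 0` satisfies every field, so a zero-letter ORBIT-TIED `B12Provisos` exists (p607123∕p608883:
the `bgI` pin alone is idle; here: the tie alone is idle; together, with NF, they bite).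

WHAT IS PROVED (kernel bookkeeping; theorems only, def-free, sorry-free, standard axioms; nothing of NODE 00 ∕ p07 ∕ pub-balaban ∕ lit re-declared).  PART 1
(`…N09B12ZeroLetterFlatness`, imported) proves the estimate: every `B12Package Rz cB λ` with `λ.K = 0` returns, at an admissible input `Φ` with `(𝐀, τ, B′) = (0, 1, 0)`, a datum `Φ₀`
whose pinned `(k+1)`-background is `δ₀(λ)`-flat on `X` (`norm_plaq_bg_repr_sub_one_le_of_zero_letters`; `δ₀(λ) = e^{c_w}·(ξ²·2B₃y² + ½(4x′)²ξ²e^{4ξx′})` at `λ.consts`,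
`ξ = L⁻ʲ`, `x′ = B₃²O(1)Mα₀L^{j−1}η`, `y = B₃O(1)Mα₀L^{j−1}η`, `c_w = O(1)Mα₁ + 2B₃O(1)Mα₀ + B₃²O(1)Mα₀`).  HERE:
* §3 ★★★ `not_exists_orbitTied_package_of_nonflat` (zero-`𝐊` layer, `0 ∈ (3.31)`, `0 < α₃`, NF(δ₀): no ORBIT-TIED `B12Package`), `not_exists_exactTied_package_of_nonflat` (the exact tie
  `Φ₀ = Φ`), ★★★ `failingLemma_orbitTied_of_nonflat` (№209's lemma under TIE ∧ NF(δ₀): `¬ (B12Provisos Rz cB λ ∧ ∃ tied package)`; the letter `𝐀₂` is not even needed).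
* §4 ★ `b12Provisos_orbitTied_of_flat`, ★ `exists_orbitTied_b12Provisos_of_flat`, `…_unit`, `…_RzOfRecord` — at every TOTALLY-FLAT recipe a zero-letter ORBIT-TIED `B12Provisos`
  exists (dag-n09-c's `exists_residB12Run_restrictions` BY NAME; p607123's junk `JInputs` with `Φ₀ :=` the input's own (i)–(iv)-representative, by choice from `Φ ∈ space …`).

WHAT THIS MEANS FOR FLAG №7 (located; for director-ym ∕ dag-lead ∕ plan ∕ the def-T ∕ def-B12 desk ∕ referees).  The repair «proviso text» has a kernel-checkable
minimal form: (T) a `JInputs` edition whose datum is tied to the input's orbit (one field: `∃ u, Gᶜ-valued ∧ Φ = act u Φ₀`; print p. 278), AND (P) a pin of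
`Sect2.Residual.bgI` whose `(k+1)`-backgrounds are first-order NON-FLAT on `X` for some admissible input (NF(δ₀), displayed; print's averaged [15]-minimisers of a
non-pure-gauge small field).  (T) without (P): junk survives (§4, at `RzOfRecord` verbatim).  (P) without (T): junk survives (p607123 ∕ p608883).  (T) ∧ (P): №209's lemma
(§3).  A pin of the letter maps `λ.K` to [15]'s chart (def-B12's `ChartB12Run`, n09-w1's road) is the THIRD edit print makes; §3 shows it is not needed for the failing
lemma itself — `𝐊 = 0` already contradicts (T) ∧ (P).

HONEST FRAMING: LOCATED, count-neutral kernel bookkeeping on NODE 00's ∕ p07's ∕ pub-balaban's ∕ lit's objects read BY NAME; HYPOTHESIS-FORM — the tie (T) and the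
non-flatness (P) are DISPLAYED hypotheses about a package ∕ a recipe, asserted of NO pin of record; `δ₀` is OUR explicit constant (no optimisation); the zero letters are a
witness for the BINDERS, NOT print's letters — NOT Lemma 4 for `U_j(□₀, ·)`; NO estimate of Bałaban's is proved or denied; N09 NOT discharged; FLAG №7 neither closed
nor widened (its repair is located as two named text edits); K0⁷ ∕ K1⁷ NOT closed; counts unmoved (typed 28∕28 · discharged 5∕27); no summit statement is proved by this
seat; one finite four-torus programme at fixed `ε = L^{−K}` per run — conditional finite-𝕋⁴ bookkeeping; R4 closes rung `BalabanLadder.UV` only; NOT ℝ⁴, NOT infinite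
volume, NOT OS, NOT a mass gap, NOT Clay.
-/

noncomputable section

namespace Summit.QuantumFields.YangMills.BalabanUVNodes.N09B12FailingLemmaUnderOrbitTie

open Literature.MathematicalPhysics.QuantumFieldTheory.Balaban1983to89
open Literature.MathematicalPhysics.QuantumFieldTheory.Balaban1983to89.Node00
open Literature.MathematicalPhysics.QuantumFieldTheory.Balaban1983to89.T4Continuum (T4Family)
open Summit.QuantumFields.YangMills.BalabanUVNodes.N09B12ZeroLetterFlatness (norm_plaq_bg_repr_sub_one_le_of_zero_letters)
open B12RegularSpaces111 (Frame Region StepConsts Model space Satisfies act expI grad plaq gaugeU)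
open B12RegularSpaces111Mono (plaq_one expI_zero)
open B12RegularSpaces111Gauge (plaq_gaugeU gaugeU_one)
open B12Eq18Current (current)
open B12Eq311CurrentExpansion (C311)
open B12RegularSpaces111SpecialUnitary (suModel)
open B12Lemma4Models (slProj)
open B12Lemma4ConcreteFrame (JInputs)
open scoped Matrix.Norms.L2Operator

/-! ## §3. Under the ORBIT-TIE and first-order NON-FLATNESS of the pinned `bgI`: no zero-letter tied package — №209's lemma under the repaired text -/

section Package

variable {P : Params} {N M : ℕ} {Rz : Sect2.Residual P (MatA N)} {cB : ℝ}

/-- **★★★ NO ORBIT-TIED ZERO-LETTER PACKAGE AT A FIRST-ORDER NON-FLAT PIN.**  Let `λ` be a residual [B12] layer with `λ.K = 0`, `0 ∈ (3.31)`, `0 < α₃`, and suppose (NF(δ₀)): SOME admissible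
input `Φ ∈ U′ᶜ_{k+1}(□₀, (1+2β)α₀, (1+2β)α₁, α₀)` has, at EVERY (i)–(iv)-representative `Φ₀` of its orbit (`Φ = act u Φ₀`, `u` `Gᶜ`-valued), an `X`-plaquette of the pinned background
`U_{k+1}(□₀, M˙(Φ₀))` off `1` by MORE than `δ₀(λ)`.  Then NO by-reference package `B12Package Rz cB λ` satisfies the ORBIT-TIE «its datum `Φ₀` is a representative of the
input's orbit» (print p. 278: the datum of (3.39)–(3.40) is the Lemma-4 variable `𝐔` itself). [cite: Balaban1987RG1, (3.39)–(3.40) p.278, Lemma 4 p.280; (1.16) p.262] -/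
theorem not_exists_orbitTied_package_of_nonflat (lam : ResidB12Run P N M) (hK : ∀ Φ A τ, lam.K Φ A τ = 0)
    (h0 : (0 : PBond P 0 → MatA N) ∈ lam.A331) (hα₃ : 0 < lam.consts.α₃)
    (hNF : ∃ Φ ∈ space (suModel N) (lam.frameBox Rz) (lam.csBox cB) ((1 + 2 * lam.consts.β) * lam.consts.α₀) ((1 + 2 * lam.consts.β) * lam.consts.α₁) lam.α₀,
      ∀ (u : Site P 0 → (MatA N)ˣ) (Φ₀ : FieldPair P 0 (MatA N)ˣ (MatA N)), (∀ x, u x ∈ (suModel N).Gc) →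
        Satisfies (suModel N) (lam.frameBox Rz) (lam.csBox cB) ((1 + 2 * lam.consts.β) * lam.consts.α₀) ((1 + 2 * lam.consts.β) * lam.consts.α₁) lam.α₀ Φ₀ →
          Φ = act u Φ₀ → ∃ p ∈ (lam.frameX Rz).X.plaqs,
            Real.exp (lam.consts.O₁ * lam.consts.M * lam.consts.α₁ + lam.consts.B₃ * lam.consts.O₁ * lam.consts.M * lam.consts.α₀
                + lam.consts.B₃ * lam.consts.O₁ * lam.consts.M * lam.consts.α₀ + lam.consts.B₃ ^ 2 * lam.consts.O₁ * lam.consts.M * lam.consts.α₀) *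
              ((lam.csX cB).ξ ^ 2 * (2 * (lam.consts.B₃ * (lam.consts.B₃ * lam.consts.O₁ * lam.consts.M * lam.consts.α₀ * (lam.consts.L ^ (lam.idx.j - 1) * lam.idx.η)) ^ 2))
                + 1 / 2 * (4 * (lam.consts.B₃ ^ 2 * lam.consts.O₁ * lam.consts.M * lam.consts.α₀ * (lam.consts.L ^ (lam.idx.j - 1) * lam.idx.η))) ^ 2 * (lam.csX cB).ξ ^ 2
                    * Real.exp ((lam.csX cB).ξ * (4 * (lam.consts.B₃ ^ 2 * lam.consts.O₁ * lam.consts.M * lam.consts.α₀ * (lam.consts.L ^ (lam.idx.j - 1) * lam.idx.η))))) <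
              ‖((plaq ((lam.frameBox Rz).bg.Un (lam.csBox cB).j Φ₀.U) p : (MatA N)ˣ) : MatA N) - 1‖) :
    ¬ ∃ pkg : B12Package Rz cB lam, ∀ Φ A τ B' hΦ hA hτ0 hτ1 hB', ∃ u : Site P 0 → (MatA N)ˣ,
        (∀ x, u x ∈ (suModel N).Gc) ∧ Φ = act u (pkg.inputs Φ A τ B' hΦ hA hτ0 hτ1 hB').Φ₀ := by
  rintro ⟨pkg, hTie⟩
  obtain ⟨Φ, hΦ, hNF⟩ := hNF
  have hB' : ‖(0 : PBond P 0 → MatA N)‖ < lam.consts.α₃ := by rw [norm_zero]; exact hα₃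
  obtain ⟨u, hu, hact⟩ := hTie Φ 0 1 0 hΦ h0 zero_le_one le_rfl hB'
  obtain ⟨p, hp, hlt⟩ := hNF u _ hu (pkg.inputs Φ 0 1 0 hΦ h0 zero_le_one le_rfl hB').hΦ₀ hact
  exact (not_lt.mpr (norm_plaq_bg_repr_sub_one_le_of_zero_letters lam hK pkg h0 hα₃ hΦ p hp)) hlt

/-- **★★★ THE SAME UNDER THE EXACT TIE `Φ₀ = Φ`** (the datum IS the input): then NF needs only ONE admissible input with an `X`-plaquette of its OWN pinned `(k+1)`-background off `1` by
more than `δ₀(λ)`. [cite: Balaban1987RG1, (3.39)–(3.40) p.278, Lemma 4 p.280] -/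
theorem not_exists_exactTied_package_of_nonflat (lam : ResidB12Run P N M) (hK : ∀ Φ A τ, lam.K Φ A τ = 0)
    (h0 : (0 : PBond P 0 → MatA N) ∈ lam.A331) (hα₃ : 0 < lam.consts.α₃)
    (hNF : ∃ Φ ∈ space (suModel N) (lam.frameBox Rz) (lam.csBox cB) ((1 + 2 * lam.consts.β) * lam.consts.α₀) ((1 + 2 * lam.consts.β) * lam.consts.α₁) lam.α₀,
      ∃ p ∈ (lam.frameX Rz).X.plaqs,
        Real.exp (lam.consts.O₁ * lam.consts.M * lam.consts.α₁ + lam.consts.B₃ * lam.consts.O₁ * lam.consts.M * lam.consts.α₀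
            + lam.consts.B₃ * lam.consts.O₁ * lam.consts.M * lam.consts.α₀ + lam.consts.B₃ ^ 2 * lam.consts.O₁ * lam.consts.M * lam.consts.α₀) *
          ((lam.csX cB).ξ ^ 2 * (2 * (lam.consts.B₃ * (lam.consts.B₃ * lam.consts.O₁ * lam.consts.M * lam.consts.α₀ * (lam.consts.L ^ (lam.idx.j - 1) * lam.idx.η)) ^ 2))
            + 1 / 2 * (4 * (lam.consts.B₃ ^ 2 * lam.consts.O₁ * lam.consts.M * lam.consts.α₀ * (lam.consts.L ^ (lam.idx.j - 1) * lam.idx.η))) ^ 2 * (lam.csX cB).ξ ^ 2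
                * Real.exp ((lam.csX cB).ξ * (4 * (lam.consts.B₃ ^ 2 * lam.consts.O₁ * lam.consts.M * lam.consts.α₀ * (lam.consts.L ^ (lam.idx.j - 1) * lam.idx.η))))) <
          ‖((plaq ((lam.frameBox Rz).bg.Un (lam.csBox cB).j Φ.U) p : (MatA N)ˣ) : MatA N) - 1‖) :
    ¬ ∃ pkg : B12Package Rz cB lam, ∀ Φ A τ B' hΦ hA hτ0 hτ1 hB', (pkg.inputs Φ A τ B' hΦ hA hτ0 hτ1 hB').Φ₀ = Φ := by
  rintro ⟨pkg, hTie⟩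
  obtain ⟨Φ, hΦ, p, hp, hlt⟩ := hNF
  have hB' : ‖(0 : PBond P 0 → MatA N)‖ < lam.consts.α₃ := by rw [norm_zero]; exact hα₃
  have h := norm_plaq_bg_repr_sub_one_le_of_zero_letters lam hK pkg h0 hα₃ hΦ p hp
  rw [hTie Φ 0 1 0 hΦ h0 zero_le_one le_rfl hB'] at h
  exact (not_lt.mpr h) hlt

/-- **★★★ №209's «FAILING LEMMA» UNDER THE TIED PROVISO TEXT**: at a residual recipe `Rz` and a zero-`𝐊` layer `λ` meeting NF(δ₀(λ)) (displayed), `λ` does NOT carry the honest horn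
`B12Provisos Rz cB λ` TOGETHER WITH an orbit-tied by-reference package — i.e. once `JInputs.Φ₀` is tied to the input (edit (T)) and `bgI` is pinned to a first-order non-flat
background functional (edit (P)), p585162's ∕ p607123's construction FAILS, as director-ym №209 asks; the letter `𝐀₂` is not even needed for the failure.  LOCATED; hypothesis-form.
[cite: Balaban1987RG1, Lemma 4 (3.53) p.280, (3.39)–(3.40) p.278 (bookkeeping)] -/
theorem failingLemma_orbitTied_of_nonflat (lam : ResidB12Run P N M) (hK : ∀ Φ A τ, lam.K Φ A τ = 0)
    (hNF : ∃ Φ ∈ space (suModel N) (lam.frameBox Rz) (lam.csBox cB) ((1 + 2 * lam.consts.β) * lam.consts.α₀) ((1 + 2 * lam.consts.β) * lam.consts.α₁) lam.α₀,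
      ∀ (u : Site P 0 → (MatA N)ˣ) (Φ₀ : FieldPair P 0 (MatA N)ˣ (MatA N)), (∀ x, u x ∈ (suModel N).Gc) →
        Satisfies (suModel N) (lam.frameBox Rz) (lam.csBox cB) ((1 + 2 * lam.consts.β) * lam.consts.α₀) ((1 + 2 * lam.consts.β) * lam.consts.α₁) lam.α₀ Φ₀ →
          Φ = act u Φ₀ → ∃ p ∈ (lam.frameX Rz).X.plaqs,
            Real.exp (lam.consts.O₁ * lam.consts.M * lam.consts.α₁ + lam.consts.B₃ * lam.consts.O₁ * lam.consts.M * lam.consts.α₀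
                + lam.consts.B₃ * lam.consts.O₁ * lam.consts.M * lam.consts.α₀ + lam.consts.B₃ ^ 2 * lam.consts.O₁ * lam.consts.M * lam.consts.α₀) *
              ((lam.csX cB).ξ ^ 2 * (2 * (lam.consts.B₃ * (lam.consts.B₃ * lam.consts.O₁ * lam.consts.M * lam.consts.α₀ * (lam.consts.L ^ (lam.idx.j - 1) * lam.idx.η)) ^ 2))
                + 1 / 2 * (4 * (lam.consts.B₃ ^ 2 * lam.consts.O₁ * lam.consts.M * lam.consts.α₀ * (lam.consts.L ^ (lam.idx.j - 1) * lam.idx.η))) ^ 2 * (lam.csX cB).ξ ^ 2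
                    * Real.exp ((lam.csX cB).ξ * (4 * (lam.consts.B₃ ^ 2 * lam.consts.O₁ * lam.consts.M * lam.consts.α₀ * (lam.consts.L ^ (lam.idx.j - 1) * lam.idx.η))))) <
              ‖((plaq ((lam.frameBox Rz).bg.Un (lam.csBox cB).j Φ₀.U) p : (MatA N)ˣ) : MatA N) - 1‖) :
    ¬ (B12Provisos Rz cB lam ∧ ∃ pkg : B12Package Rz cB lam, ∀ Φ A τ B' hΦ hA hτ0 hτ1 hB', ∃ u : Site P 0 → (MatA N)ˣ,
        (∀ x, u x ∈ (suModel N).Gc) ∧ Φ = act u (pkg.inputs Φ A τ B' hΦ hA hτ0 hτ1 hB').Φ₀) := by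
  rintro ⟨hP, hTie⟩
  exact not_exists_orbitTied_package_of_nonflat lam hK hP.zero_mem hP.restrictions.2.2.2.1 hNF hTie

end Package

/-! ## §4. The tie ALONE is idle: at every TOTALLY-FLAT recipe a zero-letter, ORBIT-TIED package inhabits `B12Provisos` (so the `bgI` pin (P) is needed besides the tie (T)) -/

section Flat

variable {P : Params} {N M : ℕ} {Rz : Sect2.Residual P (MatA N)} {cB : ℝ}

/-- `exp iξ·0 = 1` as a configuration. [cite: Balaban1987RG1, (1.13) p.262 (bookkeeping)] -/
private theorem expI_zero_cfg (ξ : ℝ) : (fun b : PBond P 0 => expI ξ ((0 : PBond P 0 → MatA N) b)) = 1 := by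
  funext b; rw [Pi.zero_apply, expI_zero]; rfl

/-- `exp iξ(0 + 0) = 1` as a configuration. [cite: Balaban1987RG1, (1.13) p.262 (bookkeeping)] -/
private theorem expI_zero_add_zero_cfg (ξ : ℝ) :
    (fun b : PBond P 0 => expI ξ ((0 : PBond P 0 → MatA N) b + (0 : PBond P 0 → MatA N) b)) = 1 := by
  funext b; rw [Pi.zero_apply, add_zero, expI_zero]; rfl

variable [NeZero N]

/-- The cost of the unit gauge transformation: `‖1‖·‖1⁻¹‖ ≤ e^{x}` for `0 ≤ x`. [folklore] -/
private theorem cost_one {x : ℝ} (hx : 0 ≤ x) (y : Site P 0) :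
    ‖((1 : Site P 0 → (MatA N)ˣ) y : MatA N)‖ * ‖(↑((1 : Site P 0 → (MatA N)ˣ) y)⁻¹ : MatA N)‖ ≤ Real.exp x := by
  simp only [Pi.one_apply, inv_one, Units.val_one, norm_one, mul_one]
  have := Real.add_one_le_exp x
  linarith

/-- **The zero-letter `JInputs` TIED TO THE INPUT'S ORBIT over a TOTALLY-FLAT recipe** (`∂U_m(M˙(V)) = 1`, `J_m(M˙(V)) = 0` for EVERY `V`): datum `Φ₀ :=` an (i)–(iv)-representative of the
input `Φ` (from `Φ ∈ space …`, choice), `𝐇 = H₁ = 0`, `ℓ = 0`, all gauge transformations `1`; (3.39) ∕ (3.42) hold because the pinned background of `Φ₀` is flat ∕ current-free, the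
rest as in p607123's junk instance.  A witness for the BINDERS under edit (T) alone; NOT print's letters. [cite: Balaban1987RG1, (3.37)–(3.52) pp.277–280 (bookkeeping: the junk instance)] -/
private theorem exists_jInputs_zero_tied
    (hUn : ∀ j Y m V p, plaq ((Rz.bgI j Y).Un m V) p = 1) (hJn : ∀ j Y m V b, (Rz.bgI j Y).Jn m V b = 0)
    (lam : ResidB12Run P N M)
    (hB₃ : 0 < lam.consts.B₃) (hO₁ : 0 < lam.consts.O₁) (hM : 0 < lam.consts.M) (hβ : 0 < lam.consts.β) (hα₀ : 0 < lam.consts.α₀) (hα₁ : 0 < lam.consts.α₁)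
    (hB'' : 0 ≤ lam.B₃'') (K A : PBond P 0 → MatA N) (hK : K = 0) (hA : A = 0) {Φ : FieldPair P 0 (MatA N)ˣ (MatA N)}
    (hΦ : Φ ∈ space (suModel N) (lam.frameBox Rz) (lam.csBox cB) ((1 + 2 * lam.consts.β) * lam.consts.α₀) ((1 + 2 * lam.consts.β) * lam.consts.α₁) lam.α₀)
    (τ : ℝ) {n : ℝ} (hn : 0 ≤ n) :
    ∃ J : JInputs (suModel N) lam.consts (lam.frameX Rz) (lam.frameBox Rz) (lam.csX cB) (lam.csBox cB) lam.regionY (slProj N) lam.idx.η lam.B₃'' lam.α₀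
        lam.idx.j τ n K A,
      ∃ u : Site P 0 → (MatA N)ˣ, (∀ x, u x ∈ (suModel N).Gc) ∧ Φ = act u J.Φ₀ := by
  subst hK hA
  obtain ⟨u, Φ₀, hu, hΦ₀, rfl⟩ := hΦ
  have hL : 0 < lam.consts.L := Nat.cast_pos.mpr P.L_pos
  have hη : 0 < lam.idx.η := pow_pos (inv_pos.mpr (Nat.cast_pos.mpr P.L_pos)) _
  have hS1 : 0 < lam.consts.B₃ ^ 2 * lam.consts.O₁ * lam.consts.M * lam.consts.α₀ * (lam.consts.L ^ (lam.idx.j - 1) * lam.idx.η) := by positivity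
  have hS2 : 0 < lam.consts.B₃ * (lam.consts.B₃ * lam.consts.O₁ * lam.consts.M * lam.consts.α₀ * (lam.consts.L ^ (lam.idx.j - 1) * lam.idx.η)) ^ 2 := by positivity
  have hS3 : 0 < lam.consts.β * lam.consts.α₀ * (lam.consts.L ^ (lam.idx.j - 1) * lam.idx.η) ^ 2 := by positivity
  have hUnX : ∀ m p, plaq ((lam.frameX Rz).bg.Un m (1 : PBond P 0 → (MatA N)ˣ)) p = 1 := fun m p => hUn _ _ m _ p
  have hJnX : ∀ m b, (lam.frameX Rz).bg.Jn m (1 : PBond P 0 → (MatA N)ˣ) b = 0 := fun m b => hJn _ _ m _ b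
  have hUnB : ∀ m p, plaq ((lam.frameBox Rz).bg.Un m Φ₀.U) p = 1 := fun m p => hUn _ _ m _ p
  have hJnB : ∀ m b, (lam.frameBox Rz).bg.Jn m Φ₀.U b = 0 := fun m b => hJn _ _ m _ b
  refine ⟨
    { Φ₀ := Φ₀
      hΦ₀ := hΦ₀
      H := 0, H₁ := 0, ℓ := 0, uj := 1, ubar1 := 1, vj := 1, v := 1, ubar := fun _ => 1, w₁ := fun _ => 1
      ctr := fun _ x => x
      hKgc := fun _ => (suModel N).gc.zero_mem
      hAgc := fun _ => (suModel N).gc.zero_mem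
      huj := cost_one (by positivity)
      hubar1 := cost_one (by positivity)
      hvj := cost_one (by positivity)
      hv := cost_one (by positivity)
      hubar := fun _ _ => rfl
      h339 := fun p _ => by
        rw [expI_zero_cfg, plaq_gaugeU, hUnB, plaq_one, mul_one, mul_inv_cancel]
      h342 := fun b _ => by
        rw [expI_zero_cfg, B12Eq44Space.current_one, hJnB, smul_zero, mul_zero, zero_mul]
      h338 := fun m _ _ p _ => by
        rw [expI_zero_add_zero_cfg, plaq_gaugeU, hUnX, plaq_one, mul_one, mul_inv_cancel]
      hJn := fun m _ _ b _ => by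
        rw [expI_zero_add_zero_cfg, hJnX, inv_one, mul_one, gaugeU_one, B12Eq44Space.current_one]
      h338₁ := fun m _ _ p _ => by
        rw [hUnX, gaugeU_one, plaq_one]
      hJn₁ := fun m _ _ b _ => by
        rw [hJnX, gaugeU_one, B12Eq44Space.current_one]
      hH := fun b => by rw [Pi.zero_apply, norm_zero]; exact hS1
      hHd := fun μ ν y => by
        simp only [grad, Pi.zero_apply, sub_self, smul_zero, norm_zero]
        exact hS1
      h45 := fun p _ => by
        simp only [Pi.zero_apply, add_zero, sub_self, smul_zero, norm_zero]
        exact hS2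
      hK := fun b => by rw [Pi.zero_apply, norm_zero]; exact hS1
      hKd := fun μ ν y => by
        simp only [grad, Pi.zero_apply, sub_self, smul_zero, norm_zero]
        exact hS1
      h45τ := fun p _ => by
        simp only [Pi.zero_apply, add_zero, sub_self, smul_zero, norm_zero]
        exact hS2
      hA := fun b => by rw [Pi.zero_apply, norm_zero]; positivity
      hAd := fun μ ν y => by
        simp only [grad, Pi.zero_apply, sub_self, smul_zero, norm_zero]
        positivity
      hS := fun b _ => by
        rw [sub_zero, B12CondIIIJConcreteModels.lapCur_zero, norm_zero]
        exact hS3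
      hSτ := fun b _ => by
        rw [smul_zero, sub_zero, B12CondIIIJConcreteModels.lapCur_zero, norm_zero]
        exact hS3
      hA2 := fun b _ => by
        rw [B12CondIIIJConcreteModels.lapCur_zero, norm_zero]
        positivity }, u, hu, rfl⟩

/-- **★ AN ORBIT-TIED ZERO-LETTER `B12Provisos` OVER A TOTALLY-FLAT RECIPE**: for a residual layer with zero letters, `X ⊆ □̃³`, `0 ∈ (3.31)`, constants meeting «all the
restrictions» and the seven further ones, `B12Provisos Rz cB λ` holds AND `B12Package Rz cB λ` is inhabited by a package whose EVERY datum `Φ₀` is a representative of the input's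
orbit — edit (T) alone does not exclude the junk when the pinned `bgI` is totally flat. [cite: Balaban1987RG1, Lemma 4 (3.53) p.280 with (3.26)–(3.52) pp.275–280 (bookkeeping: the junk instance)] -/
theorem b12Provisos_orbitTied_of_flat
    (hUn : ∀ j Y m V p, plaq ((Rz.bgI j Y).Un m V) p = 1) (hJn : ∀ j Y m V b, (Rz.bgI j Y).Jn m V b = 0)
    (lam : ResidB12Run P N M) (hX3 : lam.idx.XSites ⊆ lam.idx.boxT 3)
    (hK : ∀ Φ A τ, lam.K Φ A τ = 0) (hA₂ : ∀ Φ A τ B', lam.A₂ Φ A τ B' = 0) (h0 : (0 : PBond P 0 → MatA N) ∈ lam.A331)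
    (hR : B12Sec2to5.Lemma4Restrictions lam.consts)
    (hB : 1 ≤ lam.consts.B₃) (hY : 1 ≤ lam.consts.B₃ ^ 2 * lam.consts.O₁ * lam.consts.M)
    (hα₁ : 16 * (lam.consts.O₁ * lam.consts.M * lam.consts.α₁) ≤ lam.consts.β) (hL10 : 1 + 10 * lam.consts.β ≤ lam.consts.L ^ 2)
    (hB'' : 0 ≤ lam.B₃'') (hres'' : lam.B₃'' * lam.consts.α₃ ≤ lam.consts.β * lam.consts.L⁻¹ ^ 2 * lam.consts.α₀)
    (hresJ : 4 * ((P.d - 1) * ((2 : ℝ) * C311 1)) * (lam.consts.B₃ ^ 2 * lam.consts.O₁ * lam.consts.M) ^ 2 * lam.consts.α₀ ≤ lam.consts.β) :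
    B12Provisos Rz cB lam ∧ ∃ pkg : B12Package Rz cB lam, ∀ Φ A τ B' hΦ hA hτ0 hτ1 hB', ∃ u : Site P 0 → (MatA N)ˣ,
      (∀ x, u x ∈ (suModel N).Gc) ∧ Φ = act u (pkg.inputs Φ A τ B' hΦ hA hτ0 hτ1 hB').Φ₀ := by
  obtain ⟨hα₀, hα₁', -, -, hβ, -⟩ := id hR
  have hB₃ : 0 < lam.consts.B₃ := one_pos.trans_le hB
  have hMnn : 0 ≤ lam.consts.M := Nat.cast_nonneg M
  have hOM : 0 < lam.consts.O₁ * lam.consts.M := by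
    by_contra hle
    rw [not_lt] at hle
    have : lam.consts.B₃ ^ 2 * lam.consts.O₁ * lam.consts.M ≤ 0 := by
      rw [mul_assoc]; exact mul_nonpos_of_nonneg_of_nonpos (sq_nonneg _) hle
    linarith
  have hMpos : 0 < lam.consts.M := by
    rcases hMnn.eq_or_lt with hM0 | hM0
    · rw [← hM0, mul_zero] at hOM; exact absurd hOM (lt_irrefl 0)
    · exact hM0
  have hO₁ : 0 < lam.consts.O₁ := by
    by_contra hle
    rw [not_lt] at hle
    have : lam.consts.O₁ * lam.consts.M ≤ 0 := mul_nonpos_iff.mpr (Or.inr ⟨hle, hMpos.le⟩)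
    linarith
  let pkg : B12Package Rz cB lam :=
    { hB := hB, hY := hY, hα₁ := hα₁, hL10 := hL10, hB'' := hB'', hres'' := hres'', hresJ := hresJ
      hXb := lam.frameX_X_bonds_subset_regionY Rz hX3
      hXd := lam.frameX_X_dpairs_subset_regionY Rz hX3
      hX₂b := lam.frameX_X₂_bonds_subset_regionY Rz hX3
      hX₂p := lam.frameX_X₂_plaqs_subset_X Rz
      hXp' := lam.frameX_X_plaqs_subset_frameBox_X₂ Rz hX3
      hYb' := lam.regionY_bonds_subset_frameBox_X₂ Rz
      hXp := lam.stencil_subset_regionY Rz hX3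
      inputs := fun Φ A τ B' hΦ _ _ _ _ =>
        Classical.choose (exists_jInputs_zero_tied hUn hJn lam hB₃ hO₁ hMpos hβ hα₀ hα₁' hB'' _ _ (hK Φ A τ) (hA₂ Φ A τ B') hΦ τ
          (norm_nonneg B'))
      hKan := fun τ _ _ _ _ _ _ b => by
        simp only [hK, Pi.zero_apply]
        exact analyticAt_const
      hA2an := fun τ _ _ _ _ _ _ b => by
        simp only [hA₂, Pi.zero_apply]
        exact analyticAt_const }
  exact ⟨⟨⟨pkg⟩, hR, h0⟩, pkg, fun Φ A τ B' hΦ _ _ _ _ =>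
    Classical.choose_spec (exists_jInputs_zero_tied hUn hJn lam hB₃ hO₁ hMpos hβ hα₀ hα₁' hB'' _ _ (hK Φ A τ) (hA₂ Φ A τ B') hΦ τ
      (norm_nonneg B'))⟩

/-- **★ THE TIE ALONE IS IDLE**: over every TOTALLY-FLAT residual recipe (`∂U_m(M˙(V)) ≡ 1`, `J_m(M˙(V)) ≡ 0` for every configuration `V`; cube size `M ≥ 1`) SOME zero-letter
residual [B12] layer (dag-n09-c's `exists_residB12Run_restrictions` instance with its letters replaced by `0`) carries `B12Provisos Rz cB λ` (any `cB`) BY an ORBIT-TIED package — so edit (T) without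
the pin (P) does not deliver №209's lemma; compare §3 (T ∧ P deliver it) and p607123 ∕ p608883 (P without T does not). LOCATED; count-neutral.
[cite: Balaban1987RG1, Lemma 4 (3.53) p.280, (3.39)–(3.40) p.278, (1.15)–(1.16) p.262 (bookkeeping)] -/
theorem exists_orbitTied_b12Provisos_of_flat
    (hUn : ∀ j Y m V p, plaq ((Rz.bgI j Y).Un m V) p = 1) (hJn : ∀ j Y m V b, (Rz.bgI j Y).Jn m V b = 0) (hM : 1 ≤ M) :
    ∃ lam : ResidB12Run P N M, (∀ Φ A τ, lam.K Φ A τ = 0) ∧ (∀ Φ A τ B', lam.A₂ Φ A τ B' = 0) ∧ B12Provisos Rz cB lam ∧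
      ∃ pkg : B12Package Rz cB lam, ∀ Φ A τ B' hΦ hA hτ0 hτ1 hB', ∃ u : Site P 0 → (MatA N)ˣ,
        (∀ x, u x ∈ (suModel N).Gc) ∧ Φ = act u (pkg.inputs Φ A τ B' hΦ hA hτ0 hτ1 hB').Φ₀ := by
  obtain ⟨lam, hX, h0, hR, hB, hY, hα₁, hL10, hB'', hres'', hresJ⟩ := exists_residB12Run_restrictions P N M hM P.hL.2
  refine ⟨{ lam with K := fun _ _ _ => 0, A₂ := fun _ _ _ _ => 0 }, fun _ _ _ => rfl, fun _ _ _ _ => rfl, ?_⟩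
  exact b12Provisos_orbitTied_of_flat hUn hJn _ (IdxB12.XSites_subset_boxT_three_of_two _ hX) (fun _ _ _ => rfl) (fun _ _ _ _ => rfl)
    h0 hR hB hY hα₁ hL10 hB'' hres'' hresJ

/-- **★ … IN PARTICULAR AT def-T's UNIT RECIPE** `Sect2.Residual.unit` (= `RzOfRecord F N K` of `Record12Residuals`, by `rfl`): its `U_n(M˙(·)) ≡ 1`, `J_n ≡ 0` are totally flat, so a
zero-letter ORBIT-TIED `B12Provisos` exists there — the tie (T) alone leaves FLAG №7's junk in place at the recipe of record. LOCATED; count-neutral.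
[cite: Balaban1987RG1, (1.15) p.262, Lemma 4 p.280 (bookkeeping)] -/
theorem exists_orbitTied_b12Provisos_unit (hM : 1 ≤ M) :
    ∃ lam : ResidB12Run P N M, (∀ Φ A τ, lam.K Φ A τ = 0) ∧ (∀ Φ A τ B', lam.A₂ Φ A τ B' = 0) ∧
      B12Provisos (Sect2.Residual.unit P (MatA N)) cB lam ∧
      ∃ pkg : B12Package (Sect2.Residual.unit P (MatA N)) cB lam, ∀ Φ A τ B' hΦ hA hτ0 hτ1 hB', ∃ u : Site P 0 → (MatA N)ˣ,
        (∀ x, u x ∈ (suModel N).Gc) ∧ Φ = act u (pkg.inputs Φ A τ B' hΦ hA hτ0 hτ1 hB').Φ₀ :=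
  exists_orbitTied_b12Provisos_of_flat (fun _ _ _ _ p => plaq_one p) (fun _ _ _ _ _ => rfl) hM

/-- **★ … AT `RzOfRecord F N K`** (Record12's residual §2 data of record on the `K`-th torus = the unit recipe, by `rfl`): a zero-letter ORBIT-TIED `B12Provisos (RzOfRecord F N K) cB λ`
exists — the tie (T) alone leaves FLAG №7's junk in place at the recipe of record; the `bgI` pin (P) is needed too. LOCATED; count-neutral.
[cite: Balaban1987RG1, (1.15) p.262, Lemma 4 p.280 (bookkeeping)] -/
theorem exists_orbitTied_b12Provisos_RzOfRecord (F : T4Family) (K : ℕ) {M : ℕ} (hM : 1 ≤ M) {cB : ℝ} :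
    ∃ lam : ResidB12Run (F.P K) N M, (∀ Φ A τ, lam.K Φ A τ = 0) ∧ (∀ Φ A τ B', lam.A₂ Φ A τ B' = 0) ∧
      B12Provisos (RzOfRecord F N K) cB lam ∧
      ∃ pkg : B12Package (RzOfRecord F N K) cB lam, ∀ Φ A τ B' hΦ hA hτ0 hτ1 hB', ∃ u : Site (F.P K) 0 → (MatA N)ˣ,
        (∀ x, u x ∈ (suModel N).Gc) ∧ Φ = act u (pkg.inputs Φ A τ B' hΦ hA hτ0 hτ1 hB').Φ₀ :=
  exists_orbitTied_b12Provisos_unit hM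

end Flat

end Summit.QuantumFields.YangMills.BalabanUVNodes.N09B12FailingLemmaUnderOrbitTie

end
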